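import Summits.BirchSwinnertonDyer.BirchSwinnertonDyer.Theorems.KatoDescentPotSupersingularCartanMuRoadRealClassNumberDoors
import Literature.NumberTheory.EllipticCurves.FineSelmerMuRoadDoors
import Literature.NumberTheory.EllipticCurves.DivisionFieldClassNumberInvolutionDescent
import Literature.NumberTheory.IwasawaTheory.ClassicalMuInvariantOnePrimeProofs
import HarnessLib

/-!
# Route `KatoDescentPotSupersingular` (rung K9, sub-rung B5 = O6 wild `p = 3`, cell `bsd-potss`): the IMAGE-FREE μ-road door on the WHOLE
# division field `ℚ(W[3])` — U₀ `MissingUpperBoundAt W 3` on an irreducible rank-`0` O6 row from TWO CLASS-GROUP INTEGERS of `ℚ(W[3])`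
# (Iwasawa 1956: `3 ∤ h`, one prime above `3`), with Iwasawa's 1956 theorem DISCHARGED by the tree theorem
# `iwasawa1956_classNumberPExp_eq_zero_of_not_dvd_classNumber_of_unique_prime_holds`
# (seat `bsd-potss-k9-c4` g22; route-free; `--supports stmt-BirchSwinnertonDyer-19197 --as helper`; closes nothing)

HONEST FRAMING. THEOREMS ONLY (no definition, no named fact, no `sorry`); nothing is booked; items 19189 / 19197 / 19942 stay OPEN at
class level; (A), Conjecture A and BSD are proved for NO curve here.  This is the K9 (`ClassO6 W 3`) twin of seat k8t-c4 g18's (t′) door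
`CartanMuRoadDoorsTprimeFive.missingUpperBoundAt_tame_of_not_dvd_classNumber_divisionField_of_unique_prime` (§5, p644815).

THE ROAD.  `MissingUpperBoundAt W 3` (`ord₃ #Ш(W) ≤ ord₃ #Ш_an(W)`) ⟸ k9-c4 g5's fine-Selmer port of Kato 14.5 (3)
(`WildFineSelmerSupersingularCMAnchor.missingUpperBoundAt_wild_of_conjA`: named facts A161-fine `hKatoA`, GZK `hGZK`, modularity `hmod`;
`r_an = 0`, `ClassO6 W 3`, `W[3]` irreducible) ⟸ statement (A) at `(W,3)` ⟸ Coates–Sujatha Thm. 3.4 (`hCS`, named fact) ⟸ classical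
`μ = 0` for the cyclotomic `ℤ₃`-extension of `L = ℚ(W[3])` ⟸ IWASAWA 1956: `3 ∤ h(L)` and `L` has exactly one prime above `3` — and the
last implication is the tree THEOREM `iwasawa1956_…_holds` (Literature `ClassicalMuInvariantOnePrimeProofs`, from Washington Thm. 10.4),
so the door displays NO μ-hypothesis, NO image datum, NO Ferrero–Washington / Iwasawa-growth / Fukuda fact: only `hKatoA hGZK hmod hCS`
and the two integers of `L`.  §1 gives the (A)-level doors at any odd `p` (the `hIw`-free forms of conjA-anchor g8's
`CartanMuRoadDoors.conjA_of_not_dvd_classNumber_of_unique_prime` and of the GRH-free involution form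
`CoatesSujatha2005.fineSelmerDual_moduleFinite_of_unique_prime_of_involutions`, p576582); §2 the U₀ doors at `p = 3`; §3 the `hIw`-free
form of this seat's g18 REAL-SUBFIELD door (`K⁺ = ℚ(W[3])^c`, `CartanMuRoadRealDoors.…_of_realClassNumber`, p630180).

USE (this seat's records `…WildUpperMuRoadThreeClassNumberRecordsNN`, g22): the 167 U₀-ns `3Nn` rows of 19189 → 19197 on which
conjA-anchor g8's census (kit j289900) finds `h(ℚ(E[3])) ∈ {1,4,8,16,64,256}` and `3𝓞_L = 𝔓⁸` with `f = 2` (one prime) — a SECOND road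
beside the unit-twist records, with displayed inputs disjoint from the unit-twist road's four held facts.

References: [Iwasawa1956]; [Greenberg2001IwasawaPastPresent] Prop. 2.1 (p. 339); [Washington1997] Thm. 10.4, Prop. 13.22;
[CoatesSujatha2005] Thm. 3.4 (§3); [Kato2004Asterisque] Thm. 12.5 (3), Thm. 14.5 (3); [NeukirchANT1999] Ch. III §1 (1.6) (iv).
-/

set_option linter.dupNamespace false
set_option autoImplicit false

noncomputable section

open scoped NumberField
open Field IntermediateField WeierstrassCurve IsDedekindDomain Literature.NumberTheory.EllipticCurves
  Literature.NumberTheory.GaloisRepresentations Literature.NumberTheory.SerreUniformity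
  Literature.NumberTheory.IwasawaTheory Literature.NumberTheory.EllipticCurves.Rank1Residual.Typed
  Summit.BirchSwinnertonDyer.Rank1Residual.Additive

namespace Summit.BirchSwinnertonDyer.BirchSwinnertonDyer.Theorems.DivisionFieldClassNumberDoor

/-! ## §1 Statement (A) at `(W, p)`, `p` odd, from Iwasawa 1956 on `ℚ(W[p])` — the named fact `hIw` discharged -/

section ConjA

variable (W : WeierstrassCurve ℚ) [W.IsElliptic]

/-- **(A) at `(W, p)` from the Iwasawa-1956 certificate of `ℚ(W[p])`** (`p` odd; `p ∤ h(ℚ(W[p]))`, exactly one prime above `p`),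
modulo the single named fact Coates–Sujatha Thm. 3.4 (`hCS`): conjA-anchor g8's `CartanMuRoadDoors.conjA_of_not_dvd_classNumber_of_unique_prime`
with its hypothesis `hIw` (Iwasawa 1956) DISCHARGED by the tree theorem `iwasawa1956_…_holds`.  CONDITIONAL on `hCS`; (A) is not asserted.
[cite: Greenberg2001IwasawaPastPresent, Prop. 2.1 p. 339] [cite: Washington1997, Thm. 10.4, Prop. 13.22] [cite: CoatesSujatha2005, Thm. 3.4 (§3)] -/
theorem conjA_of_not_dvd_classNumber_divisionField_of_unique_prime
    (hCS : CoatesSujatha2005.thm34_fineSelmerDual_moduleFinite_of_classicalMuVanishes_divisionField)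
    (p : ℕ) [Fact p.Prime] (hp : p ≠ 2)
    (hh : haveI : NeZero p := ⟨(Fact.out : p.Prime).ne_zero⟩
      haveI : NumberField (W.divisionField p) := NumberField.mk
      ¬ p ∣ NumberField.classNumber (W.divisionField p))
    (hv : haveI : NeZero p := ⟨(Fact.out : p.Prime).ne_zero⟩
      haveI : NumberField (W.divisionField p) := NumberField.mk
      ∃! v : HeightOneSpectrum (𝓞 (W.divisionField p)), ((p : ℕ) : 𝓞 (W.divisionField p)) ∈ v.asIdeal)
    (κ : ZpExtension ℚ p) (hκ : κ.IsCyclotomic) :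
    ∃ (γ : absoluteGaloisGroup ℚ) (D : W.FineSelmerDualData κ γ),
      Module.Finite ℤ_[p] (RestrictScalars ℤ_[p] (IwasawaAlgebra p) D.X) :=
  CoatesSujatha2005.fineSelmerDual_moduleFinite_of_not_dvd_classNumber_of_unique_prime
    iwasawa1956_classNumberPExp_eq_zero_of_not_dvd_classNumber_of_unique_prime_holds hCS W p hp hh hv κ hκ

/-- **(A) at `(W, p)` from the GRH-free INVOLUTION certificate** (`p` odd): conjA-anchor g8's
`CoatesSujatha2005.fineSelmerDual_moduleFinite_of_unique_prime_of_involutions` (two index-2 subfields of `ℚ(W[p])` with class number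
prime to `p` — for a Cartan-normaliser image at `p = 3` the octic fields `ℚ(P)` and `ℚ(x(W[3]))` — replace `p ∤ h(ℚ(W[p]))`) with `hIw`
DISCHARGED.  Displayed: `τ_b, τ_g, τ_z ∈ Γ_ℚ` with `τ_b² = τ_z² = 1` and `τ_z = τ_b τ_g τ_b τ_g⁻¹` ON `W[p]`, the two class numbers, and one
prime of `ℚ(W[p])` above `p`.  CONDITIONAL on `hCS`; (A) is not asserted. [cite: NeukirchANT1999, Ch. III §1 Prop. (1.6) (iv)]
[cite: Greenberg2001IwasawaPastPresent, Prop. 2.1 p. 339] [cite: CoatesSujatha2005, Thm. 3.4 (§3)] -/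
theorem conjA_of_unique_prime_of_involutions
    (hCS : CoatesSujatha2005.thm34_fineSelmerDual_moduleFinite_of_classicalMuVanishes_divisionField)
    (p : ℕ) [Fact p.Prime] (hp2 : p ≠ 2) (τb τg τz : absoluteGaloisGroup ℚ)
    (hb : haveI : NeZero p := ⟨(Fact.out : p.Prime).ne_zero⟩
      ∀ T : geomTorsion W (p : ℤ), τb • (τb • T) = T)
    (hz : haveI : NeZero p := ⟨(Fact.out : p.Prime).ne_zero⟩
      ∀ T : geomTorsion W (p : ℤ), τz • (τz • T) = T)
    (hrel : haveI : NeZero p := ⟨(Fact.out : p.Prime).ne_zero⟩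
      ∀ T : geomTorsion W (p : ℤ), τz • T = τb • (τg • (τb • (τg⁻¹ • T))))
    (hKb : haveI : NeZero p := ⟨(Fact.out : p.Prime).ne_zero⟩
      haveI : NumberField (W.divisionField p) := NumberField.mk
      ¬ p ∣ NumberField.classNumber (fixedField (Subgroup.zpowers (absRestrictNormalHom (W.divisionField p) τb))))
    (hKz : haveI : NeZero p := ⟨(Fact.out : p.Prime).ne_zero⟩
      haveI : NumberField (W.divisionField p) := NumberField.mk
      ¬ p ∣ NumberField.classNumber (fixedField (Subgroup.zpowers (absRestrictNormalHom (W.divisionField p) τz))))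
    (hv : haveI : NeZero p := ⟨(Fact.out : p.Prime).ne_zero⟩
      haveI : NumberField (W.divisionField p) := NumberField.mk
      ∃! v : HeightOneSpectrum (𝓞 (W.divisionField p)), ((p : ℕ) : 𝓞 (W.divisionField p)) ∈ v.asIdeal)
    (κ : ZpExtension ℚ p) (hκ : κ.IsCyclotomic) :
    ∃ (γ : absoluteGaloisGroup ℚ) (D : W.FineSelmerDualData κ γ),
      Module.Finite ℤ_[p] (RestrictScalars ℤ_[p] (IwasawaAlgebra p) D.X) :=
  CoatesSujatha2005.fineSelmerDual_moduleFinite_of_unique_prime_of_involutions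
    iwasawa1956_classNumberPExp_eq_zero_of_not_dvd_classNumber_of_unique_prime_holds hCS W p hp2 τb τg τz hb hz hrel hKb hKz
    hv κ hκ

end ConjA

/-! ## §2 U₀ `MissingUpperBoundAt W 3` on an irreducible rank-`0` O6 row from Iwasawa 1956 on `ℚ(W[3])` -/

section Upper

variable (W : WeierstrassCurve ℚ) [W.IsElliptic] [W.IsGloballyMinimal]

set_option synthInstance.maxHeartbeats 400000 in
/-- **U₀ at an irreducible rank-`0` O6 row from TWO CLASS-GROUP INTEGERS of `ℚ(W[3])`** (the image-free μ-road door, K9 twin of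
k8t-c4's §5): `MissingUpperBoundAt W 3` (`ord₃ #Ш(W) ≤ ord₃ #Ш_an(W)`) for `r_an = 0`, `ClassO6 W 3`, `W[3]` irreducible, from the named
facts A161-fine `hKatoA`, GZK `hGZK`, modularity `hmod`, Coates–Sujatha Thm. 3.4 `hCS`, and the displayed `hh : 3 ∤ h(ℚ(W[3]))`,
`hv :` «exactly one prime of `ℚ(W[3])` above `3`» — Iwasawa 1956 being the tree theorem `iwasawa1956_…_holds`.  CONDITIONAL; nothing
booked; BSD for no curve. [cite: Kato2004Asterisque, Thm. 14.5 (3) (p. 236), Thm. 12.5 (3) (p. 222)] [cite: CoatesSujatha2005, Thm. 3.4 (§3)]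
[cite: Greenberg2001IwasawaPastPresent, Prop. 2.1 p. 339] [cite: Washington1997, Thm. 10.4, Prop. 13.22] -/
theorem missingUpperBoundAt_three_of_not_dvd_classNumber_divisionField_of_unique_prime
    (hKatoA : Kato2004.rankZero_padicValNat_sha_add_padicValNat_tamagawa_le_of_additive_potGood_of_irreducible_of_fineSelmerDual_fg)
    (hGZK : rank_eq_analyticRank_of_analyticRank_le_one) (hmod : hasEntireLFunction_rat)
    (hCS : CoatesSujatha2005.thm34_fineSelmerDual_moduleFinite_of_classicalMuVanishes_divisionField) [Fact (3 : ℕ).Prime]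
    (hr : W.analyticRank = 0) (hO : ClassO6 W 3) (hirr : W.HasIrreducibleModPGaloisRep 3)
    (hh : haveI : NumberField (W.divisionField 3) := NumberField.mk
      ¬ 3 ∣ NumberField.classNumber (W.divisionField 3))
    (hv : haveI : NumberField (W.divisionField 3) := NumberField.mk
      ∃! v : HeightOneSpectrum (𝓞 (W.divisionField 3)), ((3 : ℕ) : 𝓞 (W.divisionField 3)) ∈ v.asIdeal) :
    MissingUpperBoundAt W 3 :=
  WildFineSelmerSupersingularCMAnchor.missingUpperBoundAt_wild_of_conjA hKatoA hGZK hmod W hr hO hirr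
    (conjA_of_not_dvd_classNumber_divisionField_of_unique_prime W hCS 3 (by decide) hh hv)

set_option synthInstance.maxHeartbeats 400000 in
/-- **U₀ at an irreducible rank-`0` O6 row from the GRH-free INVOLUTION certificate of `ℚ(W[3])`**: as
`missingUpperBoundAt_three_of_not_dvd_classNumber_divisionField_of_unique_prime` with `3 ∤ h(ℚ(W[3]))` replaced by the class numbers of
the fixed fields of two involutions `τ_b|_L`, `τ_z|_L` with `τ_z = τ_b τ_g τ_b τ_g⁻¹` on `W[3]` (for a Cartan-normaliser image: `ℚ(P)` and
`ℚ(x(W[3]))`, degree 8 on `3Nn` rows).  CONDITIONAL on `hKatoA hGZK hmod hCS`; nothing booked; BSD for no curve.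
[cite: Kato2004Asterisque, Thm. 14.5 (3) (p. 236)] [cite: NeukirchANT1999, Ch. III §1 Prop. (1.6) (iv)] [cite: CoatesSujatha2005, Thm. 3.4 (§3)] -/
theorem missingUpperBoundAt_three_of_unique_prime_of_involutions
    (hKatoA : Kato2004.rankZero_padicValNat_sha_add_padicValNat_tamagawa_le_of_additive_potGood_of_irreducible_of_fineSelmerDual_fg)
    (hGZK : rank_eq_analyticRank_of_analyticRank_le_one) (hmod : hasEntireLFunction_rat)
    (hCS : CoatesSujatha2005.thm34_fineSelmerDual_moduleFinite_of_classicalMuVanishes_divisionField) [Fact (3 : ℕ).Prime]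
    (hr : W.analyticRank = 0) (hO : ClassO6 W 3) (hirr : W.HasIrreducibleModPGaloisRep 3) (τb τg τz : absoluteGaloisGroup ℚ)
    (hb : ∀ T : geomTorsion W ((3 : ℕ) : ℤ), τb • (τb • T) = T) (hz : ∀ T : geomTorsion W ((3 : ℕ) : ℤ), τz • (τz • T) = T)
    (hrel : ∀ T : geomTorsion W ((3 : ℕ) : ℤ), τz • T = τb • (τg • (τb • (τg⁻¹ • T))))
    (hKb : haveI : NumberField (W.divisionField 3) := NumberField.mk
      ¬ 3 ∣ NumberField.classNumber (fixedField (Subgroup.zpowers (absRestrictNormalHom (W.divisionField 3) τb))))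
    (hKz : haveI : NumberField (W.divisionField 3) := NumberField.mk
      ¬ 3 ∣ NumberField.classNumber (fixedField (Subgroup.zpowers (absRestrictNormalHom (W.divisionField 3) τz))))
    (hv : haveI : NumberField (W.divisionField 3) := NumberField.mk
      ∃! v : HeightOneSpectrum (𝓞 (W.divisionField 3)), ((3 : ℕ) : 𝓞 (W.divisionField 3)) ∈ v.asIdeal) :
    MissingUpperBoundAt W 3 :=
  WildFineSelmerSupersingularCMAnchor.missingUpperBoundAt_wild_of_conjA hKatoA hGZK hmod W hr hO hirr
    (conjA_of_unique_prime_of_involutions W hCS 3 (by decide) τb τg τz hb hz hrel hKb hKz hv)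

end Upper

/-! ## §3 The REAL-SUBFIELD door of g18 (`K⁺ = ℚ(W[3])^c`, `3Nn` rows) with Iwasawa 1956 discharged -/

section Real

variable (W : WeierstrassCurve ℚ) [W.IsElliptic] [W.IsGloballyMinimal]

/-- **U₀ at a `3Nn` row from Iwasawa's 1956 criterion on the maximal real subfield `K⁺ = ℚ(W[3])^c`** — this seat's g18 door
`CartanMuRoadRealDoors.missingUpperBoundAt_three_of_hasModPImageEqNonsplitCartanNormalizer_of_realClassNumber` (p630180) with the named
fact `hIw` DISCHARGED by `iwasawa1956_…_holds`; still modulo Iwasawa's growth theorem `hI` and Ferrero–Washington `hFW` (the passage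
`K⁺ ↝ ℚ(W[3])`), the image predicate `3Nn` and a complex conjugation `c`; displayed `hh : 3 ∤ h(K⁺)` (degree 8) and `hv`.  CONDITIONAL;
nothing booked; BSD for no curve. [cite: Kato2004Asterisque, Thm. 14.5 (3) (p. 236)] [cite: Greenberg2001IwasawaPastPresent, Prop. 2.1 p. 339]
[cite: CoatesSujatha2005, Thm. 3.4 (§3)] -/
theorem missingUpperBoundAt_three_of_hasModPImageEqNonsplitCartanNormalizer_of_realClassNumber
    (hKatoA : Kato2004.rankZero_padicValNat_sha_add_padicValNat_tamagawa_le_of_additive_potGood_of_irreducible_of_fineSelmerDual_fg)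
    (hGZK : rank_eq_analyticRank_of_analyticRank_le_one) (hmod : hasEntireLFunction_rat)
    (hCS : CoatesSujatha2005.thm34_fineSelmerDual_moduleFinite_of_classicalMuVanishes_divisionField)
    (hI : iwasawa1959_classNumberPExp_growth) (hFW : ferreroWashington1979_classicalMuVanishes) [Fact (3 : ℕ).Prime]
    (hr : W.analyticRank = 0) (hO : ClassO6 W 3) (hirr : W.HasIrreducibleModPGaloisRep 3)
    (himg : HasModPImageEqNonsplitCartanNormalizer W 3) {c : absoluteGaloisGroup ℚ} (hc : IsComplexConjugation (Rat.castHom ℝ) c)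
    (hh : haveI : NumberField ↥(W.divisionField 3) := NumberField.mk
      ¬ 3 ∣ NumberField.classNumber ↥(fixedField (Subgroup.zpowers (absRestrictNormalHom (W.divisionField 3) c))))
    (hv : haveI : NumberField ↥(W.divisionField 3) := NumberField.mk
      ∃! v : HeightOneSpectrum (𝓞 ↥(fixedField (Subgroup.zpowers (absRestrictNormalHom (W.divisionField 3) c)))),
        ((3 : ℕ) : 𝓞 ↥(fixedField (Subgroup.zpowers (absRestrictNormalHom (W.divisionField 3) c)))) ∈ v.asIdeal) :
    MissingUpperBoundAt W 3 :=
  CartanMuRoadRealDoors.missingUpperBoundAt_three_of_hasModPImageEqNonsplitCartanNormalizer_of_realClassNumber W hKatoA hGZK hmod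
    hCS hI hFW iwasawa1956_classNumberPExp_eq_zero_of_not_dvd_classNumber_of_unique_prime_holds hr hO hirr himg hc hh hv

end Real

end Summit.BirchSwinnertonDyer.BirchSwinnertonDyer.Theorems.DivisionFieldClassNumberDoor

end
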